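import Literature.Combinatorics.Sahi2008.FKG
import Summits.CriticalPhenomena.PercolationContinuityZ3.Theorems.PercNearOneGluingNoHeavyLowerTailSahiTotalE3

/-!
# `NoHeavyLowerTail` (crux stmt-CriticalPhenomena-4575), Sahi programme P1: the ALIGNED case of the law of total `E₃` —
# a product of two Sahi-3-positive weights is Sahi-3-positive on every monotone triple whose conditional covariances are monotone

Support file (Sahi cell, seat `prim-sahi-p1`, generation 46; `--supports stmt-CriticalPhenomena-4575`).  Pure proofs, no definitions,
no `sorry`, standard axioms.  Vocabulary of `Literature/Combinatorics/Sahi2008/Functional.lean` (`ex`, `sahiE`, `SahiPositive`) and the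
law of total `E₃` of `…SahiTotalE3` (`SahiTotalE3.sahiE_three_total`, seat prim-l12-p5):
  `E₃^{ν⊗κ}(f,g,h) = E_ν[b ↦ E₃^κ(f_b,g_b,h_b)] + E₃^ν(F,G,H) + Σ_cyc E₂^ν(F, b ↦ E₂^κ(g_b,h_b))`,   `F b = E_κ f_b` (sectional means).

THE MATHEMATICS.  The first two terms are instances of `C₃` for the two factors; the cross term `Σ_cyc Cov_ν(F, Cov_κ(g_·,h_·))` is the
only one without a sign, because the CONDITIONAL COVARIANCE `b ↦ Cov_κ(g_b,h_b)` of two monotone functions need not be monotone in `b`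
(for up-set indicators on `β × {0,1}` it is `p(1−p)·1[(B₁∖B₀)∩(C₁∖C₀)]`, the indicator of an order-convex 'corner' set — the measure-level
form of the corner cell / `V`-layer obstruction of the grid-pattern programme, memos gen28 §2.1, gen44, gen45 §1.4/§6).  When the three
conditional covariances ARE monotone ('aligned sections') every term is nonnegative:
* **`sahiE_three_prodWeight_nonneg_of_monotone_condCov`**: `ν ≥ 0` on `β` and `κ ≥ 0` on `γ` Sahi-positive of orders `2` and `3`, `f, g, h ≥ 0` monotone on
  `β × γ` (product order, curried as `β → γ → ℝ` with `f` monotone in each argument), and `b ↦ E₂^κ(g_b,h_b)`, `b ↦ E₂^κ(f_b,h_b)`, `b ↦ E₂^κ(f_b,g_b)` monotone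
  ⟹ `0 ≤ E₃^{ν⊗κ}(f,g,h)`;
* `sahiE_three_prodWeight_nonneg_of_isFKGMeasure`: the same for FKG probability weights on finite distributive lattices that are Sahi-positive of order `3`
  (order `2` is then the FKG inequality, `sahiPositive_two`).
So 'Sahi-3-positive × Sahi-3-positive ⇒ Sahi-3-positive' holds on the aligned part of the cone of monotone triples and fails to be FORMAL exactly through
the cross term (with `γ = {0,1}` the unrestricted statement would give Kahn's Conjecture 5 by induction on the number of coordinates).
HONEST LABEL: Sahi's Conjecture 5 (`C₃`), Kahn's Conjecture 5 and `PatternPos d` (`d ≥ 5`) remain OPEN; nothing here asserts them. [this work]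
-/

namespace Summit.CriticalPhenomena.PercolationContinuityZ3.Theorems.SahiTotalE3

open Finset Literature.Combinatorics.Sahi2008
open scoped BigOperators

variable {β γ : Type*} [Fintype β] [Fintype γ]

section Aligned

variable [Preorder β] [Preorder γ]

omit [Fintype β] [Preorder γ] in
/-- Sectional means `b ↦ E_κ(f b)` of a function monotone in its first argument are monotone (nonnegative weight). [folklore] -/
theorem monotone_sectionMean {κ : γ → ℝ} (hκ : ∀ c, 0 ≤ κ c) {f : β → γ → ℝ} (hf : ∀ c, Monotone fun b => f b c) :
    Monotone fun b => ex κ (f b) :=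
  fun _ _ hb => ex_mono hκ fun c => hf c hb

omit [Fintype β] [Preorder β] [Preorder γ] in
/-- Sectional means of a nonnegative function are nonnegative (nonnegative weight). [folklore] -/
theorem sectionMean_nonneg {κ : γ → ℝ} (hκ : ∀ c, 0 ≤ κ c) {f : β → γ → ℝ} (hf : ∀ b c, 0 ≤ f b c) (b : β) :
    0 ≤ ex κ (f b) :=
  ex_nonneg hκ fun c => hf b c

omit [Preorder β] in
/-- `E₂^κ ≥ 0` on a pair of nonnegative monotone functions, from order-two Sahi positivity. [cite: LiebSahi2021, eq. (1.2)] -/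
theorem sahiE_two_nonneg_of_sahiPositive {κ : γ → ℝ} (hκ : SahiPositive κ 2) {u v : γ → ℝ}
    (hu : ∀ c, 0 ≤ u c) (hv : ∀ c, 0 ≤ v c) (hum : Monotone u) (hvm : Monotone v) :
    0 ≤ sahiE κ 2 ![u, v] := by
  refine hκ _ (fun i c => ?_) (fun i => ?_)
  · fin_cases i
    · exact hu c
    · exact hv c
  · fin_cases i
    · exact hum
    · exact hvm

omit [Preorder β] in
/-- `E₃^κ ≥ 0` on a triple of nonnegative monotone functions, from order-three Sahi positivity. [cite: LiebSahi2021, eq. (1.2)] -/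
theorem sahiE_three_nonneg_of_sahiPositive {κ : γ → ℝ} (hκ : SahiPositive κ 3) {u v w : γ → ℝ}
    (hu : ∀ c, 0 ≤ u c) (hv : ∀ c, 0 ≤ v c) (hw : ∀ c, 0 ≤ w c) (hum : Monotone u) (hvm : Monotone v)
    (hwm : Monotone w) : 0 ≤ sahiE κ 3 ![u, v, w] := by
  refine hκ _ (fun i c => ?_) (fun i => ?_)
  · fin_cases i
    · exact hu c
    · exact hv c
    · exact hw c
  · fin_cases i
    · exact hum
    · exact hvm
    · exact hwm

/-- **The aligned case of the law of total `E₃`.**  Let `ν ≥ 0` on `β` and `κ ≥ 0` on `γ` be Sahi-positive of orders `2` and `3`, and let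
`f, g, h : β → γ → ℝ` be nonnegative and monotone in each argument.  If the three CONDITIONAL COVARIANCES `b ↦ E₂^κ(g b, h b)`,
`b ↦ E₂^κ(f b, h b)`, `b ↦ E₂^κ(f b, g b)` are monotone in `b`, then `0 ≤ E₃^{ν⊗κ}(f,g,h)` for the product weight `(b,c) ↦ ν b · κ c`:
by `SahiTotalE3.sahiE_three_total` every term is nonnegative (sectional `E₃ ≥ 0` by `C₃(κ)`; `E₃` of the sectional means by `C₃(ν)`; each
cross term is a `ν`-covariance of two nonnegative monotone functions, the conditional covariance being `≥ 0` by `C₂(κ)`).  The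
monotonicity hypotheses are NOT automatic — they are exactly what fails at the 'corner cell' of the grid-pattern programme. [this work] -/
theorem sahiE_three_prodWeight_nonneg_of_monotone_condCov {ν : β → ℝ} {κ : γ → ℝ} (hν0 : ∀ b, 0 ≤ ν b)
    (hκ0 : ∀ c, 0 ≤ κ c) (hν2 : SahiPositive ν 2) (hν3 : SahiPositive ν 3) (hκ2 : SahiPositive κ 2)
    (hκ3 : SahiPositive κ 3) {f g h : β → γ → ℝ} (hf : ∀ b c, 0 ≤ f b c) (hg : ∀ b c, 0 ≤ g b c)
    (hh : ∀ b c, 0 ≤ h b c) (hf₁ : ∀ c, Monotone fun b => f b c) (hg₁ : ∀ c, Monotone fun b => g b c)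
    (hh₁ : ∀ c, Monotone fun b => h b c) (hf₂ : ∀ b, Monotone (f b)) (hg₂ : ∀ b, Monotone (g b))
    (hh₂ : ∀ b, Monotone (h b))
    (hgh : Monotone fun b => sahiE κ 2 ![g b, h b]) (hfh : Monotone fun b => sahiE κ 2 ![f b, h b])
    (hfg : Monotone fun b => sahiE κ 2 ![f b, g b]) :
    0 ≤ sahiE (fun p : β × γ => ν p.1 * κ p.2) 3 ![fun p => f p.1 p.2, fun p => g p.1 p.2, fun p => h p.1 p.2] := by
  rw [sahiE_three_total ν (fun _ => κ) f g h]
  have hF := monotone_sectionMean hκ0 hf₁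
  have hG := monotone_sectionMean hκ0 hg₁
  have hH := monotone_sectionMean hκ0 hh₁
  have hF0 := sectionMean_nonneg hκ0 hf
  have hG0 := sectionMean_nonneg hκ0 hg
  have hH0 := sectionMean_nonneg hκ0 hh
  refine add_nonneg (add_nonneg ?_ ?_) (add_nonneg (add_nonneg ?_ ?_) ?_)
  · exact ex_nonneg hν0 fun b => sahiE_three_nonneg_of_sahiPositive hκ3 (hf b) (hg b) (hh b) (hf₂ b) (hg₂ b) (hh₂ b)
  · exact sahiE_three_nonneg_of_sahiPositive hν3 hF0 hG0 hH0 hF hG hH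
  · exact sahiE_two_nonneg_of_sahiPositive hν2 hF0
      (fun b => sahiE_two_nonneg_of_sahiPositive hκ2 (hg b) (hh b) (hg₂ b) (hh₂ b)) hF hgh
  · exact sahiE_two_nonneg_of_sahiPositive hν2 hG0
      (fun b => sahiE_two_nonneg_of_sahiPositive hκ2 (hf b) (hh b) (hf₂ b) (hh₂ b)) hG hfh
  · exact sahiE_two_nonneg_of_sahiPositive hν2 hH0
      (fun b => sahiE_two_nonneg_of_sahiPositive hκ2 (hf b) (hg b) (hf₂ b) (hg₂ b)) hH hfg

end Aligned

/-- **FKG-lattice form of the aligned case.**  For FKG probability weights `ν`, `κ` on finite distributive lattices that are Sahi-positive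
of order `3`, nonnegative argumentwise-monotone `f, g, h : β → γ → ℝ` with monotone conditional covariances have `E₃^{ν⊗κ}(f,g,h) ≥ 0`.
[this work] -/
theorem sahiE_three_prodWeight_nonneg_of_isFKGMeasure {β γ : Type*} [Fintype β] [Fintype γ] [DistribLattice β]
    [DistribLattice γ] {ν : β → ℝ} {κ : γ → ℝ} (hν : IsFKGMeasure ν) (hκ : IsFKGMeasure κ)
    (hν3 : SahiPositive ν 3) (hκ3 : SahiPositive κ 3) {f g h : β → γ → ℝ} (hf : ∀ b c, 0 ≤ f b c)
    (hg : ∀ b c, 0 ≤ g b c) (hh : ∀ b c, 0 ≤ h b c) (hf₁ : ∀ c, Monotone fun b => f b c)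
    (hg₁ : ∀ c, Monotone fun b => g b c) (hh₁ : ∀ c, Monotone fun b => h b c) (hf₂ : ∀ b, Monotone (f b))
    (hg₂ : ∀ b, Monotone (g b)) (hh₂ : ∀ b, Monotone (h b))
    (hgh : Monotone fun b => sahiE κ 2 ![g b, h b]) (hfh : Monotone fun b => sahiE κ 2 ![f b, h b])
    (hfg : Monotone fun b => sahiE κ 2 ![f b, g b]) :
    0 ≤ sahiE (fun p : β × γ => ν p.1 * κ p.2) 3 ![fun p => f p.1 p.2, fun p => g p.1 p.2, fun p => h p.1 p.2] :=
  sahiE_three_prodWeight_nonneg_of_monotone_condCov hν.nonneg hκ.nonneg (sahiPositive_two hν) hν3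
    (sahiPositive_two hκ) hκ3 hf hg hh hf₁ hg₁ hh₁ hf₂ hg₂ hh₂ hgh hfh hfg

end Summit.CriticalPhenomena.PercolationContinuityZ3.Theorems.SahiTotalE3
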